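import Summits.CriticalPhenomena.PercolationContinuityZ3.Theorems.PercNearOneGluingNoHeavyLowerTailSahiCoSunflowerMajAnd
import Summits.CriticalPhenomena.PercolationContinuityZ3.Theorems.PercNearOneGluingNoHeavyLowerTailSahiStrongCubicMax
import Summits.CriticalPhenomena.PercolationContinuityZ3.Theorems.PercNearOneGluingNoHeavyLowerTailSahiStrongCubicMaxSeparated
import Mathlib.Tactic.Linarith
import Mathlib.Tactic.Ring
import Mathlib.Tactic.Positivity
import HarnessLib

/-!
# `NoHeavyLowerTail` (crux stmt-CriticalPhenomena-4575), master-family line P1 (gen 16):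
# THEOREM — the one-payer conjecture S₃^max (`strongCubicMax ≥ 0`) on the "MAJORITY = AND-EVENT" stratum of co-sunflowers

Support file (seat `prim-masterthm-p1`, gen 16; `--supports stmt-CriticalPhenomena-4575`).  Pure proof file, no `sorry`, standard
axioms.  Memo `run/shared/lean/prim/prim-masterthm/FROM-prim-masterthm-p1-g16-ONE-PAYER.md` §6(3).

The typed conjecture `SahiDeepCore.StrongCubicMaxNonneg` (`max(κ,o)·(κo − e₂) ≥ e₃`) PROVED on gen 13's majority-AND stratum
(tree `…SahiCoSunflowerMajAnd`): increasing `G₁,G₂,G₃` such that every configuration outside the majority event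
`M = (G₁∩G₂)∪(G₁∩G₃)∪(G₂∩G₃)` lies below a co-atom outside `M` (so `M = contain R` is an AND-event).  Dual of the union-OR stratum;
contains the separated stratum of `…SahiStrongCubicMaxSeparated` (whose fixed-core transfer lemma `maxCells_antitone_core` is reused).
At the envelope (the AND-block composite of the dual standard system) the CORE pays exactly (`e₃ = κ·G`), value `(max(κ,o) − κ)·G ≥ 0`.
* `strongCubicMax_nonneg_of_majAnd` (S₃^max), `strongCubicPlus_nonneg_of_majAnd` (S₃⁺; gen 13 had S₃ and the class law here).
-/

noncomputable section

open scoped Classical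

namespace Summit.CriticalPhenomena.PercolationContinuityZ3.Theorems

namespace SahiDeepCore

open Finset
open Literature.Combinatorics.Sahi2008
open Literature.Probability.Percolation.DecisionTree (ind ind_of_mem ind_of_not_mem ind_nonneg)

variable {ι : Type} [Fintype ι]

local notation3 (prettyPrint := false) "m⟦" p ", " X "⟧" => ex (bernoulliWeight p) (ind X)

/-- `0 ≤ μ_p(X)`. [folklore] -/
private theorem massMA_nonneg (p : ι → unitInterval) (X : Set (Set ι)) : 0 ≤ m⟦p, X⟧ :=
  ex_nonneg (isFKGMeasure_bernoulliWeight p).nonneg fun ω => ind_nonneg _ ω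

/-- `μ_p(Y ∖ X) = μ_p(Y) − μ_p(X)` for `X ⊆ Y`. [folklore] -/
private theorem massMA_sdiff (p : ι → unitInterval) {X Y : Set (Set ι)} (h : X ⊆ Y) :
    m⟦p, Y \ X⟧ = m⟦p, Y⟧ - m⟦p, X⟧ := by
  have e : ind Y = ind X + ind (Y \ X) := by
    funext ω
    simp only [Pi.add_apply]
    by_cases hx : ω ∈ X
    · rw [ind_of_mem (h hx), ind_of_mem hx, ind_of_not_mem (fun hh : ω ∈ Y \ X => hh.2 hx), add_zero]
    · by_cases hy : ω ∈ Y
      · rw [ind_of_mem hy, ind_of_not_mem hx, ind_of_mem (show ω ∈ Y \ X from ⟨hy, hx⟩), zero_add]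
      · rw [ind_of_not_mem hy, ind_of_not_mem hx, ind_of_not_mem (fun hh : ω ∈ Y \ X => hy hh.1), add_zero]
  have := congrArg (ex (bernoulliWeight p)) e
  rw [ex_add] at this
  linarith

/-- Monotonicity of `μ_p`. [folklore] -/
private theorem massMA_mono (p : ι → unitInterval) {X Y : Set (Set ι)} (h : X ⊆ Y) : m⟦p, X⟧ ≤ m⟦p, Y⟧ := by
  have := massMA_sdiff p h
  have h0 := massMA_nonneg p (Y \ X)
  linarith

/-- **THEOREM (S₃^max when the majority event is an AND-event).**  If `G₁,G₂,G₃` are increasing events of the finite cube with a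
product weight and every configuration outside `M = (G₁∩G₂)∪(G₁∩G₃)∪(G₂∩G₃)` lies below a co-atom outside `M`, then
`0 ≤ strongCubicMax p (G₂∪G₃) (G₁∪G₃) (G₁∪G₂)`: the one-payer conjecture `StrongCubicMaxNonneg` holds on this stratum. [this work] -/
theorem strongCubicMax_nonneg_of_majAnd (p : ι → unitInterval) {G₁ G₂ G₃ : Set (Set ι)} (h₁ : IsUpperSet G₁) (h₂ : IsUpperSet G₂)
    (h₃ : IsUpperSet G₃)
    (hcogen : ∀ S : Set ι, S ∉ (G₁ ∩ G₂) ∪ (G₁ ∩ G₃) ∪ (G₂ ∩ G₃) →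
      ∃ u, u ∉ S ∧ ({u}ᶜ : Set ι) ∉ (G₁ ∩ G₂) ∪ (G₁ ∩ G₃) ∪ (G₂ ∩ G₃)) :
    0 ≤ strongCubicMax p (G₂ ∪ G₃) (G₁ ∪ G₃) (G₁ ∪ G₂) := by
  obtain ⟨s1, s2, s3⟩ := coSunflower_sandwich G₁ G₂ G₃
  obtain ⟨e3, e2, e1⟩ := coSunflower_privateParts G₁ G₂ G₃
  obtain ⟨dAB, dAC, dBC⟩ := rgrp_disjoint G₁ G₂ G₃
  have hm := mem_rgrp G₁ G₂ G₃
  set PA := rgrpA G₂ G₃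
  set PB := rgrpB G₁ G₂ G₃
  set PC := rgrpC G₁ G₂ G₃
  set R := PA ∪ PB ∪ PC with hRdef
  set a := ∏ u ∈ PA, (p u : ℝ)
  set b := ∏ u ∈ PB, (p u : ℝ)
  set c := ∏ u ∈ PC, (p u : ℝ)
  have hcore : (G₂ ∪ G₃) ∩ (G₁ ∪ G₃) ∩ (G₁ ∪ G₂) = contain R := by
    ext S
    have maj_iff : S ∈ (G₂ ∪ G₃) ∩ (G₁ ∪ G₃) ∩ (G₁ ∪ G₂) ↔ S ∈ (G₁ ∩ G₂) ∪ (G₁ ∩ G₃) ∪ (G₂ ∩ G₃) := by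
      simp only [Set.mem_inter_iff, Set.mem_union]; tauto
    rw [maj_iff]
    constructor
    · intro hS u hu
      by_contra huS
      have hc : ({u}ᶜ : Set ι) ∈ (G₁ ∩ G₂) ∪ (G₁ ∩ G₃) ∪ (G₂ ∩ G₃) := by
        rcases hS with (⟨a1, a2⟩ | ⟨a1, a3⟩) | ⟨a2, a3⟩
        · exact Or.inl (Or.inl ⟨coatom_mem_of_notMem h₁ a1 huS, coatom_mem_of_notMem h₂ a2 huS⟩)
        · exact Or.inl (Or.inr ⟨coatom_mem_of_notMem h₁ a1 huS, coatom_mem_of_notMem h₃ a3 huS⟩)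
        · exact Or.inr ⟨coatom_mem_of_notMem h₂ a2 huS, coatom_mem_of_notMem h₃ a3 huS⟩
      exact (mem_rgrp_union_iff G₁ G₂ G₃ u).1 (Finset.mem_coe.1 hu) hc
    · intro hS
      by_contra hnot
      obtain ⟨u, huS, hu⟩ := hcogen S hnot
      exact huS (hS (Finset.mem_coe.2 ((mem_rgrp_union_iff G₁ G₂ G₃ u).2 hu)))
  have hprodR : ∏ u ∈ R, (p u : ℝ) = a * b * c := by
    rw [hRdef, Finset.prod_union (Finset.disjoint_union_left.2 ⟨dAC, dBC⟩), Finset.prod_union dAB]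
  have hk : m⟦p, (G₂ ∪ G₃) ∩ (G₁ ∪ G₃) ∩ (G₁ ∪ G₂)⟧ = a * b * c := by rw [hcore, m_contain, hprodR]
  have notcore : ∀ S : Set ι, S ∉ (G₁ ∩ G₂) ∪ (G₁ ∩ G₃) ∪ (G₂ ∩ G₃) → S ∉ contain R := by
    intro S hS hc
    have : S ∈ (G₂ ∪ G₃) ∩ (G₁ ∪ G₃) ∩ (G₁ ∪ G₂) := by rw [hcore]; exact hc
    apply hS
    simp only [Set.mem_inter_iff, Set.mem_union] at this ⊢; tauto
  have pet1 : (G₂ ∪ G₃) \ (G₁ ∪ G₃) ⊆ contain (PA ∪ PC) \ contain R := by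
    rw [e2]
    intro S hS
    have hS2 : S ∈ G₂ := hS.1
    have hS1 : S ∉ G₁ := fun h => hS.2 (Or.inl h)
    have hS3 : S ∉ G₃ := fun h => hS.2 (Or.inr h)
    refine ⟨?_, notcore S ?_⟩
    · intro u hu
      by_contra huS
      have c2 := coatom_mem_of_notMem h₂ hS2 huS
      rcases Finset.mem_union.1 (Finset.mem_coe.1 hu) with h | h
      · exact ((hm u).1.1 h).1 c2
      · exact ((hm u).2.2.1 h).2.2 c2
    · simp only [Set.mem_union, Set.mem_inter_iff]; tauto
  have pet2 : (G₁ ∪ G₃) \ (G₂ ∪ G₃) ⊆ contain (PB ∪ PC) \ contain R := by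
    rw [e1]
    intro S hS
    have hS1 : S ∈ G₁ := hS.1
    have hS2 : S ∉ G₂ := fun h => hS.2 (Or.inl h)
    have hS3 : S ∉ G₃ := fun h => hS.2 (Or.inr h)
    refine ⟨?_, notcore S ?_⟩
    · intro u hu
      by_contra huS
      have c1 := coatom_mem_of_notMem h₁ hS1 huS
      rcases Finset.mem_union.1 (Finset.mem_coe.1 hu) with h | h
      · exact ((hm u).2.1.1 h).2.1 c1
      · exact ((hm u).2.2.1 h).2.1 c1
    · simp only [Set.mem_union, Set.mem_inter_iff]; tauto
  have pet3 : ((G₂ ∪ G₃) ∩ (G₁ ∪ G₃)) \ (G₁ ∪ G₂) ⊆ contain (PA ∪ PB) \ contain R := by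
    rw [e3]
    intro S hS
    have hS3 : S ∈ G₃ := hS.1
    have hS1 : S ∉ G₁ := fun h => hS.2 (Or.inl h)
    have hS2 : S ∉ G₂ := fun h => hS.2 (Or.inr h)
    refine ⟨?_, notcore S ?_⟩
    · intro u hu
      by_contra huS
      have c3 := coatom_mem_of_notMem h₃ hS3 huS
      rcases Finset.mem_union.1 (Finset.mem_coe.1 hu) with h | h
      · exact ((hm u).1.1 h).2 c3
      · exact ((hm u).2.1.1 h).2.2 c3
    · simp only [Set.mem_union, Set.mem_inter_iff]; tauto
  have env : ∀ X : Finset ι, X ⊆ R → m⟦p, contain X \ contain R⟧ = (∏ u ∈ X, (p u : ℝ)) - a * b * c := by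
    intro X hX; rw [massMA_sdiff p (contain_mono hX), m_contain, m_contain, hprodR]
  have subAC : PA ∪ PC ⊆ R :=
    Finset.union_subset (Finset.subset_union_left.trans Finset.subset_union_left) Finset.subset_union_right
  have subBC : PB ∪ PC ⊆ R :=
    Finset.union_subset (Finset.subset_union_right.trans Finset.subset_union_left) Finset.subset_union_right
  have subAB : PA ∪ PB ⊆ R := Finset.subset_union_left
  have hα : m⟦p, (G₂ ∪ G₃) \ (G₁ ∪ G₃)⟧ ≤ a * c - a * b * c := by
    refine le_trans (massMA_mono p pet1) ?_; rw [env _ subAC, Finset.prod_union dAC]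
  have hβ : m⟦p, (G₁ ∪ G₃) \ (G₂ ∪ G₃)⟧ ≤ b * c - a * b * c := by
    refine le_trans (massMA_mono p pet2) ?_; rw [env _ subBC, Finset.prod_union dBC]
  have hd : m⟦p, ((G₂ ∪ G₃) ∩ (G₁ ∪ G₃)) \ (G₁ ∪ G₂)⟧ ≤ a * b - a * b * c := by
    refine le_trans (massMA_mono p pet3) ?_; rw [env _ subAB, Finset.prod_union dAB]
  -- eliminate the outside mass; Gladkov at the actual point
  have hs := cells_sum_eq_one p (G₂ ∪ G₃) (G₁ ∪ G₃) (G₁ ∪ G₂)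
  have hG0 := gladkov_cells p (h₂.union h₃) (h₁.union h₃) (h₁.union h₂) s1 s2 s3
  have ho : m⟦p, ((G₂ ∪ G₃) ∪ (G₁ ∪ G₃))ᶜ⟧ = 1 - a * b * c - m⟦p, (G₂ ∪ G₃) \ (G₁ ∪ G₃)⟧ - m⟦p, (G₁ ∪ G₃) \ (G₂ ∪ G₃)⟧
      - m⟦p, ((G₂ ∪ G₃) ∩ (G₁ ∪ G₃)) \ (G₁ ∪ G₂)⟧ := by linarith
  simp only [strongCubicMax, gladkovDefect]
  rw [hk, ho]
  rw [hk, ho] at hG0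
  set x := m⟦p, (G₂ ∪ G₃) \ (G₁ ∪ G₃)⟧
  set y := m⟦p, (G₁ ∪ G₃) \ (G₂ ∪ G₃)⟧
  set z := m⟦p, ((G₂ ∪ G₃) ∩ (G₁ ∪ G₃)) \ (G₁ ∪ G₂)⟧
  have hx0 : 0 ≤ x := massMA_nonneg p _
  have hy0 : 0 ≤ y := massMA_nonneg p _
  have hz0 : 0 ≤ z := massMA_nonneg p _
  obtain ⟨ha0, ha1⟩ := prod_coe_mem p PA
  obtain ⟨hb0, hb1⟩ := prod_coe_mem p PB
  obtain ⟨hc0, hc1⟩ := prod_coe_mem p PC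
  set k := a * b * c with hkdef
  have hk0 : 0 ≤ k := mul_nonneg (mul_nonneg ha0 hb0) hc0
  have hG0' : 0 ≤ k * (1 - k - x - y - z) - (x * y + x * z + y * z) := by linarith
  have key := maxCells_antitone_core (k := k) hk0 hx0 hy0 hz0 hα hβ hd hG0'
  have hGenv : k * (1 - k - (a * c - k) - (b * c - k) - (a * b - k))
        - ((a * c - k) * (b * c - k) + (a * c - k) * (a * b - k) + (b * c - k) * (a * b - k))
        = k * ((1 - a) * (1 - b) * (1 - c)) := by simp only [hkdef]; ring
  have he3env : (a * c - k) * (b * c - k) * (a * b - k) = k * (k * ((1 - a) * (1 - b) * (1 - c))) := by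
    simp only [hkdef]; ring
  have hGenv0 : 0 ≤ k * ((1 - a) * (1 - b) * (1 - c)) :=
    mul_nonneg hk0 (mul_nonneg (mul_nonneg (sub_nonneg.2 ha1) (sub_nonneg.2 hb1)) (sub_nonneg.2 hc1))
  have hval : 0 ≤ max k (1 - k - (a * c - k) - (b * c - k) - (a * b - k)) *
        (k * (1 - k - (a * c - k) - (b * c - k) - (a * b - k))
          - ((a * c - k) * (b * c - k) + (a * c - k) * (a * b - k) + (b * c - k) * (a * b - k)))
        - (a * c - k) * (b * c - k) * (a * b - k) := by
    rw [hGenv, he3env]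
    have hmk : k ≤ max k (1 - k - (a * c - k) - (b * c - k) - (a * b - k)) := le_max_left _ _
    nlinarith [mul_le_mul_of_nonneg_right hmk hGenv0]
  linarith

/-- **COROLLARY (S₃⁺ on the majority-AND stratum).** [this work] -/
theorem strongCubicPlus_nonneg_of_majAnd (p : ι → unitInterval) {G₁ G₂ G₃ : Set (Set ι)} (h₁ : IsUpperSet G₁)
    (h₂ : IsUpperSet G₂) (h₃ : IsUpperSet G₃)
    (hcogen : ∀ S : Set ι, S ∉ (G₁ ∩ G₂) ∪ (G₁ ∩ G₃) ∪ (G₂ ∩ G₃) →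
      ∃ u, u ∉ S ∧ ({u}ᶜ : Set ι) ∉ (G₁ ∩ G₂) ∪ (G₁ ∩ G₃) ∪ (G₂ ∩ G₃)) :
    0 ≤ strongCubicPlus p (G₂ ∪ G₃) (G₁ ∪ G₃) (G₁ ∪ G₂) := by
  obtain ⟨s1, s2, s3⟩ := coSunflower_sandwich G₁ G₂ G₃
  exact le_trans (strongCubicMax_nonneg_of_majAnd p h₁ h₂ h₃ hcogen)
    (strongCubicMax_le_strongCubicPlus p (h₂.union h₃) (h₁.union h₃) (h₁.union h₂) s1 s2 s3)

end SahiDeepCore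

end Summit.CriticalPhenomena.PercolationContinuityZ3.Theorems
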